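import Literature.IUT.LogVolume.GenuineRamificationBoundsDatum
import Literature.IUT.LogVolume.ThetaTowerRamification
import HarnessLib

/-!
# [IUTchIV] Theorem 1.10, Step (iii) (R4) for the GENUINE division tower `F ⊆ K ⊆ F(E_F[l])` of a `λ`-line point —
# every hypothesis of the L-DH input `hR4` discharged down to the presentation of `K` (proof-only; abc-iut cell,
# campaign S, seat abc-iut-S1)

Mochizuki, *Inter-universal Teichmüller theory IV* (RIMS manuscript Apr. 2020 = PRIMS **57** (2021)), Thm. 1.10
Step (iii) (R4), p. 26 ("if `e_v ≥ p_v − 1 > p_v − 2`, then `p_v ≤ e*_mod·l`, and `log(e_v) ≤ −3 + 4·log(e*_mod·l)` — cf.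
(E3) …; (D0); Proposition 1.8, (v), (vii); [IUTchI], Definition 3.1, (c)") and Step (v), p. 28 ("`4(j+1)·ι_{v_ℚ}·l*_mod`").

`GenuineRamificationBounds(Datum).lean` reduce the L-DH input `hR4` (abc-iut-c312-d1's
`Summit.ABC.IUTFork.DHData.logμ_hullUTheta_ofInput_le_collBoundMin`) for a genuine Θ-volume input over a theta field to
the two Prop. 1.8 (vii) / (E3) inputs for `K/F` in global currency. abc-iut-S-d1's `ThetaTowerRamification.lean`
proves exactly those for `K` Galois over `F` presented inside the `l`-division field
(`ψ : K →ₐ[F] F̄`, `ker ρ̄_{E_F,l} ≤ Gal(F̄/ψ(K))`): `Cor22.exists_ramificationIdx_divisionTower_eq_pow` ("`e(u|w) = l^k` at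
`w ∤ l`") and `Cor22.finrank_divisionTower_dvd` ("`[K:F] ∣ l(l−1)²(l+1)`"). This file composes them:

* `ramificationIdx_dvd_prime_of_eq_pow` — `K/F` Galois, `e(u|w) = l^k`, `[K:F] ∣ l(l−1)²(l+1)` ⇒ `e(u|w) ∣ l`
  (`e ∣ [K:F]`, the tree's `ramificationIdx_dvd_finrank_of_isGalois`; the `l`-part of `|GL₂(𝔽_l)|` is `l`);
* `PlaceSection.R4_localFieldFamily_mono` — the monotone form of (R4): ANY `ι ≥ 0` with `ι ≥ 1` when `p ≤ e*_mod·l`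
  and ANY `lmod ≥ l*_mod` may replace the indicator and `l*_mod` (so consumers' spellings of `ι_{v_ℚ}`, `l*_mod` plug in);
* `Cor22.R4_divisionTower` — **(R4) with `e_mod := d_mod` for the genuine local fields `K_{v̲}` of ANY Θ-volume input
  `I : ThetaVolumeInput F_mod K` over a theta field `F` of `P ∈ U` and `K` Galois over `F` inside `F(E_F[l])`**: the
  hypothesis `hR4` of the L-DH Step (v) file with NO arithmetic hypothesis left beyond the presentation `(ψ, hK)` —
  which abc-iut-S-d1's `ker_galoisRepTorsion_le_fixingSubgroup_of_initialThetaData` supplies for the `K` of every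
  collection of initial Θ-data `D` ([IUTchI] Def. 3.1 (c) `range_K_iff`), i.e. for every genuine
  `T : Cor22.ThetaVolumeDatumAt P l`.

Proof-only (no definition, no named fact, no instance); classical; TAKES NO SIDE on [IUTchIII] Cor. 3.12.
-/

noncomputable section

namespace Literature.IUT.LogVolume

open NumberField IsDedekindDomain Literature.IUT.HodgeTheaters Literature.NumberTheory.NumberFields
open Literature.NumberTheory.DiophantineGeometry.GenEll

/-! ## `e(u|w) = l^k` in a Galois layer of degree dividing `|GL₂(𝔽_l)|` forces `e(u|w) ∣ l` -/

/-- For `K/F` Galois with `[K:F] ∣ l(l−1)²(l+1)` (`Gal(K/F) ↪ GL₂(𝔽_l)`) and a prime `u` of `K` with `e(u | u ∩ F) = l^k`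
(`l` prime): `e(u | u ∩ F) ∣ l` — since `e ∣ [K:F]` (Neukirch I (9.3)) and the `l`-part of `|GL₂(𝔽_l)|` is `l`. This is
the passage from the tree's form of Prop. 1.8 (vii) ("a power of `l`") to print's ("divides `n`").
[cite: Mochizuki2012, IUTchIV Prop 1.8 (vii) p.19] [cite: NeukirchANT1999, Ch. I §9 Prop. (9.3)] -/
theorem ramificationIdx_dvd_prime_of_eq_pow {F K : Type} [Field F] [NumberField F] [Field K] [NumberField K]
    [Algebra F K] [IsGalois F K] (u : HeightOneSpectrum (𝓞 K)) {l k : ℕ} (hl : l.Prime)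
    (hk : u.asIdeal.ramificationIdx (𝓞 F) = l ^ k) (hKF : Module.finrank F K ∣ l * (l - 1) ^ 2 * (l + 1)) :
    u.asIdeal.ramificationIdx (𝓞 F) ∣ l := by
  haveI : (u.asIdeal.under (𝓞 F)).IsMaximal := Ideal.IsMaximal.under (𝓞 F) u.asIdeal
  have hdvd : u.asIdeal.ramificationIdx (𝓞 F) ∣ Module.finrank F K :=
    ramificationIdx_dvd_finrank_of_isGalois (u.asIdeal.under (𝓞 F)) u.asIdeal
  exact dvd_prime_of_pow_dvd_card_GL_two hl hk (hdvd.trans hKF)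

/-! ## The monotone form of (R4) -/

namespace PlaceSection

variable {F₀ K : Type} [Field F₀] [NumberField F₀] [Field K] [NumberField K] [Algebra F₀ K]
  (σ : PlaceSection F₀ K)
variable {F : Type} [Field F] [NumberField F] [Algebra F₀ F] [Algebra F K] [IsScalarTower F₀ F K]

/-- **(R4), monotone form**: under the hypotheses of `R4_localFieldFamily`, for ANY real `ι ≥ 0` with `1 ≤ ι` whenever
`p ≤ e*_mod·l` and ANY `lmod ≥ l*_mod = log(e*_mod·l)`: `p − 2 < e(K_{v̲}) ⟹ 3 + log e(K_{v̲}) ≤ 4·ι·lmod` (the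
consumer's own spelling of `ι_{v_ℚ}` and `l*_mod`). [cite: Mochizuki2012, IUTchIV Thm 1.10 proof Step (v) p.28] -/
theorem R4_localFieldFamily_mono {p : ℕ} [hp : Fact p.Prime] (v : placesOver F₀ p) {emod l : ℕ}
    (hemod1 : 1 ≤ emod) (hemod : v.1.asIdeal.ramificationIdx ℤ ≤ emod)
    (hF : Module.finrank F₀ F ≤ 2 ^ 11 * 3 ^ 3 * 5) (hl : l.Prime)
    (hKF : Module.finrank F K ∣ l * (l - 1) ^ 2 * (l + 1))
    (htame : ((l : ℕ) : 𝓞 F) ∉ (σ.lift v.1).asIdeal.under (𝓞 F) →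
      (σ.lift v.1).asIdeal.ramificationIdx (𝓞 F) ∣ l)
    {ι lmod : ℝ} (hι0 : 0 ≤ ι) (hι1 : p ≤ 2 ^ 12 * 3 ^ 3 * 5 * emod * l → 1 ≤ ι)
    (hlmod : Real.log (((2 ^ 12 * 3 ^ 3 * 5 * emod : ℕ) : ℝ) * l) ≤ lmod) :
    p - 2 < absRamificationIdx p ((σ.localFieldFamily p hp.out).k v) →
      3 + Real.log (absRamificationIdx p ((σ.localFieldFamily p hp.out).k v)) ≤ 4 * ι * lmod := by
  intro hlt
  have h := σ.R4_localFieldFamily (F := F) v hemod1 hemod hF hl hKF htame hlt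
  have hL : 0 ≤ Real.log (((2 ^ 12 * 3 ^ 3 * 5 * emod : ℕ) : ℝ) * l) := by
    apply Real.log_nonneg
    have h1 : (1 : ℝ) ≤ ((2 ^ 12 * 3 ^ 3 * 5 * emod : ℕ) : ℝ) := by exact_mod_cast (by omega : 1 ≤ 2 ^ 12 * 3 ^ 3 * 5 * emod)
    have h2 : (1 : ℝ) ≤ l := by exact_mod_cast hl.one_lt.le
    nlinarith
  have hlmod0 : 0 ≤ lmod := hL.trans hlmod
  by_cases hι : p ≤ 2 ^ 12 * 3 ^ 3 * 5 * emod * l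
  · rw [if_pos hι, mul_one] at h
    have h1 := hι1 hι
    calc 3 + Real.log (absRamificationIdx p ((σ.localFieldFamily p hp.out).k v))
        ≤ 4 * Real.log (((2 ^ 12 * 3 ^ 3 * 5 * emod : ℕ) : ℝ) * l) := h
      _ ≤ 4 * lmod := by linarith
      _ = 4 * 1 * lmod := by ring
      _ ≤ 4 * ι * lmod := by gcongr
  · rw [if_neg hι] at h
    have : (0 : ℝ) ≤ 4 * ι * lmod := by positivity
    linarith

end PlaceSection

/-! ## (R4) for the genuine division tower -/

namespace Cor22

variable {P : NFPoint} (F : Type) [Field F] [NumberField F] [Algebra P.F F]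

/-- `1 ≤ d_mod`. [cite: Mochizuki2012, IUTchIV Thm 1.10 p.22] -/
private theorem one_le_dmod (P : NFPoint) : 1 ≤ dmod P := by
  unfold dmod; exact Module.finrank_pos

/-- **(R4) for the genuine local fields of a Θ-volume input over the division tower, `e_mod := d_mod`** ([IUTchIV] Thm.
1.10 Step (iii) (R4) p. 26 / Step (v) "`4(j+1)·ι_{v_ℚ}·l*_mod`" p. 28): for `P ∈ U`, a theta field `F` of `P`, a number
field `K` Galois over `F` presented inside the `l`-division field of `E_F` (`ψ : K →ₐ[F] F̄`,
`ker ρ̄_{E_F,l} ≤ Gal(F̄/ψ(K))`; [IUTchI] Def. 3.1 (c)), `l` prime, and ANY genuine input `I : ThetaVolumeInput F_mod K`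
(`F_mod = ℚ(j(E_F))`): at every `v ∈ V(F_mod)_p`,
`p − 2 < e(K_{v̲}) ⟹ 3 + log e(K_{v̲}) ≤ 4·ι_p·l*_mod` with `ι_p = (p ≤ d*_mod·l ? 1 : 0)`, `l*_mod = log(d*_mod·l)`,
`d*_mod = 2^12·3^3·5·d_mod` — i.e. the hypothesis `hR4` of the L-DH Step (v) file with `e_mod := d_mod`, from
(R1)–(R3) (`GenuineRamificationBounds`), `[F : F_mod] ≤ 2^11·3^3·5` (`finrank_fieldOfModuli_thetaField_le`),
`e(v|p) ≤ d_mod` (`ramificationIdx_le_dmod`) and abc-iut-S-d1's Prop. 1.8 (vii) / (E3) instances for the tower.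
[cite: Mochizuki2012, IUTchIV Thm 1.10 proof Step (iii) (R4) p.26] [cite: Mochizuki2012, IUTchIV Thm 1.10 proof Step (v) p.28] -/
theorem R4_divisionTower (hP : P ∈ UP) (hF : IsThetaField P F) {K : Type} [Field K] [NumberField K] [Algebra F K]
    [IsGalois F K] (ψ : K →ₐ[F] AlgebraicClosure F) {l : ℕ} (hl : l.Prime)
    (hK : letI := thetaCurve_isElliptic hP.1 F
      ((thetaCurve P F).galoisRepTorsion (l : ℤ)).ker ≤ ψ.fieldRange.fixingSubgroup)
    (I : letI := thetaCurve_isElliptic hP.1 F; ThetaVolumeInput (fieldOfModuli (thetaCurve P F)) K)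
    {p : ℕ} [hp : Fact p.Prime] :
    letI := thetaCurve_isElliptic hP.1 F
    ∀ v : placesOver (fieldOfModuli (thetaCurve P F)) p,
      p - 2 < absRamificationIdx p ((I.σ.localFieldFamily p hp.out).k v) →
        3 + Real.log (absRamificationIdx p ((I.σ.localFieldFamily p hp.out).k v)) ≤
          4 * (if p ≤ 2 ^ 12 * 3 ^ 3 * 5 * dmod P * l then (1 : ℝ) else 0) *
            Real.log (((2 ^ 12 * 3 ^ 3 * 5 * dmod P : ℕ) : ℝ) * l) := by
  letI := thetaCurve_isElliptic hP.1 F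
  haveI : Fact l.Prime := ⟨hl⟩
  refine R4_thetaVolumeInput F hP hF I (one_le_dmod P) (fun v => ramificationIdx_le_dmod F hP.1 v.1) hl
    (finrank_divisionTower_dvd ψ hP.1 hK) fun v hlv => ?_
  obtain ⟨k, hk⟩ := exists_ramificationIdx_divisionTower_eq_pow ψ hP.1 hF hl hK (I.σ.lift v.1) hlv
  exact ramificationIdx_dvd_prime_of_eq_pow (I.σ.lift v.1) hl hk (finrank_divisionTower_dvd ψ hP.1 hK)

end Cor22

end Literature.IUT.LogVolume

end
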